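import Summits.QuantumFields.YangMills.Theorems.LuscherReductionTwistedTraceScalingTrackDefs
import Summits.QuantumFields.YangMills.Theorems.LuscherReductionTwistedTraceScalingTrackRun
import Summits.QuantumFields.YangMills.Theorems.LuscherReductionTwistedTraceScalingTrackLemmas
import HarnessLib

/-!
# The calibrator run STAYS SMALL AT EVERY SCALE deep in the femto window (line «twolattice» skeleton rev 3, crux `TwistedTraceScaling`,
# stmt-QuantumFields-20203): `g_n² ≤ 4·lam³` for all `n ≤ k+1` and the recursion (0.20) holds exactly — the interval hypothesis of Bałaban's Theorem 1
# along any two-loop calibrator, for the next seat on the XL stub CMP-2LOOP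

Route `LuscherReduction` (owner ym-beyond-p1), LEAD ym-lead-20203-twolattice g1.  The registered TRACK stub (landed, p548356) only reports the calibrator at the
HORIZON `n = k+1`.  A prover of `stub_cmpTwoLoop` (W-REP: Bałaban's inductive representation along `L → b·M^k → … → b`) needs the effective couplings to stay
in the small-coupling interval AT EVERY SCALE ([Balaban1987RG1] Thm 1 p.259: «If the sequence of the effective coupling constants is contained in an interval
]0, γ] …»).  For any two-loop family `φ` this is exactly what the run control of `…TrackRun` delivers; THIS FILE packages it over the re-homed vocabulary:

* ★ `Track.calibrator_small_at_every_scale` — for every `M ≥ 2` and two-loop family `φ` (`Stmt.twoLoopLawH (stepBal 2 M) (twoLoopStepBal M) φ`) there is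
  `lam1(M, φ) > 0` such that in every femto window at depth `lam ≤ lam1`, on every E1 pair `(L; b, k)`, the calibrator run `g = FlowStepRuns.genSeq φ (bareBal β)`
  satisfies `0 < g_n` and `1/(4lam³) ≤ flowInvSq φ β n = 1/g_n²` for ALL `n ≤ k+1` (so `g_n² ≤ 4lam³`, uniformly small), and obeys (0.20) exactly:
  `FlowStep.RGEqH (k+1) φ g`.
Proof = the preamble of `stub_labelTracking` (constants, floor `X = 1/(4lam³)`, budget from the label identity) and the first two conclusions of
`TowerFlow.run_control`.

HONEST FRAMING: real analysis about hypothetical two-loop flow families; that Bałaban's TRUE flow is such a family is W-FLOW (NOT in print); CMP-2LOOP is OPEN;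
conditional femto rung R2b1; nothing here bears on infinite volume, a mass gap, or Clay.  No definitions, no new named facts.
-/

set_option autoImplicit false

noncomputable section

open Real
open scoped BigOperators

namespace Summit.QuantumFields.YangMills.Theorems.FemtoTransferGap.TwoLattice

open Summit.QuantumFields.YangMills.Theorems.FemtoTransferGap
open Summit.QuantumFields.YangMills.Theorems.FemtoTransferGap.TraceDoor
open Literature.MathematicalPhysics.QuantumFieldTheory.Balaban1983to89

namespace Track

set_option maxHeartbeats 400000 in
/-- ★ **The calibrator is small at every scale.**  For `M ≥ 2` and a two-loop family `φ` there is `lam1 > 0` such that deep in the femto window (`lam ≤ lam1`),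
on every E1 pair, `0 < g_n` and `1/(4lam³) ≤ 1/g_n²` for ALL `n ≤ k+1`, and the run obeys (0.20) (`RGEqH (k+1) φ g`), `g = genSeq φ (bareBal β)` — the interval
hypothesis of Bałaban's Theorem 1 along the calibrator, with `γ² = 4lam³`. [cite: Balaban1987RG1, Thm 1 p.259, (0.20) p.256] [cite: LuscherMunster1984, §2] -/
theorem calibrator_small_at_every_scale {M : ℕ} (hM : 2 ≤ M) (φ : FlowStep.HBeta)
    (hφ : Stmt.twoLoopLawH (B12Normalization.stepBal 2 M) (twoLoopStepBal M) φ) :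
    ∃ lam1 : ℝ, 0 < lam1 ∧ ∀ lam : ℝ, 0 < lam → lam ≤ lam1 →
      ∀ (L : ℕ) [NeZero L], M ^ 2 ≤ L → ∀ β : ℝ, InFemtoWindow lam β L →
        ∀ (b k : ℕ) [NeZero b], M ≤ b → b < M ^ 2 → b * M ^ (k + 1) ≤ L → L < b * M ^ k * (M + 1) →
          (∀ n, n ≤ k + 1 → 0 < FlowStepRuns.genSeq φ (bareBal β) n ∧ 1 / (4 * lam ^ 3) ≤ flowInvSq φ β n) ∧
          FlowStep.RGEqH (k + 1) φ (FlowStepRuns.genSeq φ (bareBal β)) := by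
  obtain ⟨S, γ, blow, C₁, c₀, θ₀, C₃, c₁, θ₁, k₀, hγ, _hblow, hC₁, hc₀, hθ₀, hθ₀1, hC₃, hc₁, hθ₁, hθ₁1, _hEv, hAF0, hAF1, hTL⟩ := hφ
  have hb0 : 0 < b0 := by unfold b0; positivity
  have hb1 : 0 < b1 := by unfold b1; positivity
  have hM1 : (1 : ℝ) < M := by exact_mod_cast (lt_of_lt_of_le (by norm_num) hM : 1 < M)
  have hlogM : 0 < Real.log (M : ℝ) := Real.log_pos hM1
  set a : ℝ := B12Normalization.stepBal 2 (M : ℝ) with ha_def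
  have ha8 : a = 8 * b0 * Real.log M := Track.stepBal_two_eq M
  have ha : 0 < a := by rw [ha8]; positivity
  set b1inf : ℝ := twoLoopStepBal M with hb1inf_def
  have hb1inf : 0 ≤ b1inf := by rw [hb1inf_def]; unfold twoLoopStepBal; positivity
  obtain ⟨κ, hκ⟩ : ∃ κ : ℝ, κ = b1inf / a := ⟨_, rfl⟩
  have hκ4 : κ = 4 * b1 / b0 := by rw [hκ]; exact Track.kappa_eq hM
  have hκ0 : 0 ≤ κ := by rw [hκ4]; positivity
  obtain ⟨G, hG⟩ : ∃ t : ℝ, t = c₀ / (1 - θ₀) + c₁ / (1 - θ₁) := ⟨_, rfl⟩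
  obtain ⟨gm, hgm⟩ : ∃ t : ℝ, t = min (min γ 1) (a / (8 * (C₃ + 1))) := ⟨_, rfl⟩
  obtain ⟨R, hR⟩ : ∃ t : ℝ, t = G + C₃ * (4 / a * (1 + 2 * G)) := ⟨_, rfl⟩
  obtain ⟨m, hm⟩ : ∃ t : ℝ, t = max 1 (2 * (a + b1inf + R)) := ⟨_, rfl⟩
  obtain ⟨Bc, hBc⟩ : ∃ t : ℝ, t = a + c₀ + C₁ * γ := ⟨_, rfl⟩
  obtain ⟨C₂, hC₂⟩ : ∃ t : ℝ, t = (κ * a + m ^ 2 / 2) * ((1 / m + 2 * R / m ^ 2) / a) + R / m := ⟨_, rfl⟩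
  have hG0 : 0 ≤ G := by rw [hG]; exact add_nonneg (div_nonneg hc₀ (by linarith)) (div_nonneg hc₁ (by linarith))
  have hgmpos : 0 < gm := by rw [hgm]; exact lt_min (lt_min hγ one_pos) (by positivity)
  have hR0 : 0 ≤ R := by rw [hR]; positivity
  have hm1 : 1 ≤ m := by rw [hm]; exact le_max_left _ _
  have hmpos : 0 < m := by linarith
  have hBc0 : 0 < Bc := by rw [hBc]; positivity
  have hC₂0 : 0 ≤ C₂ := by rw [hC₂]; positivity
  obtain ⟨C', hC'⟩ : ∃ t : ℝ, t = κ * (C₂ + a / m) + R := ⟨_, rfl⟩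
  have hC'0 : 0 ≤ C' := by rw [hC']; positivity
  obtain ⟨Xtot, hXtot⟩ : ∃ t : ℝ, t = m + Bc + 1 / gm ^ 2 + 4 * b0 + C' + 1 := ⟨_, rfl⟩
  have hgm2 : 0 ≤ 1 / gm ^ 2 := by positivity
  have hXtotpos : 0 < Xtot := by rw [hXtot]; linarith
  refine ⟨min 1 (1 / (4 * Xtot)), lt_min one_pos (by positivity), ?_⟩
  intro lam hlam hle L _ hL β hW b k _ hMb hbM hbL hLb
  have hl1 : lam ≤ 1 := hle.trans (min_le_left _ _)
  have hlX : lam ≤ 1 / (4 * Xtot) := hle.trans (min_le_right _ _)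
  obtain ⟨X, hX⟩ : ∃ t : ℝ, t = 1 / (4 * lam ^ 3) := ⟨_, rfl⟩
  have hXpos : 0 < X := by rw [hX]; positivity
  have hlam3 : lam ^ 3 ≤ lam := by
    calc lam ^ 3 ≤ lam ^ 1 := pow_le_pow_of_le_one hlam.le hl1 (by norm_num)
      _ = lam := pow_one lam
  have hXge : Xtot ≤ X := by
    rw [hX, le_div_iff₀ (by positivity)]
    have h1 : lam * (4 * Xtot) ≤ 1 := by rwa [le_div_iff₀ (by positivity)] at hlX
    have h2 := mul_le_mul_of_nonneg_left hlam3 (by positivity : (0 : ℝ) ≤ 4 * Xtot)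
    linarith
  rw [hXtot] at hXge
  have hX_m : m + Bc ≤ X := by linarith
  have hX_box : 1 / gm ^ 2 + Bc ≤ X := by linarith
  have hX_4b0 : 4 * b0 ≤ X := by linarith
  have hX_C' : C' ≤ X := by linarith
  -- window facts and the label identity
  obtain ⟨hv, _hΛ3, hv8, hvβ⟩ := Track.window_facts hlam hW
  obtain ⟨v, hvdef⟩ : ∃ t : ℝ, t = invRunningCoupling β L := ⟨_, rfl⟩
  rw [← hvdef] at hv hv8 hvβ
  have hvX : X ≤ 2 * v := by
    have : X = 2 * (1 / (8 * lam ^ 3)) := by rw [hX]; field_simp; ring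
    rw [this]; linarith
  have hβpos : 0 < β := by linarith [hW.1]
  have h2β : 2 * β = 4 * v + 8 * b0 * Real.log (L : ℝ) - κ * Real.log (2 * b0 / β) := by
    have h := BOHandover.invRunningCoupling_eq β L
    rw [← hvdef] at h
    rw [hκ4]
    linear_combination (-4) * h
  have hbone : 1 ≤ b := NeZero.one_le
  obtain ⟨_, _, hAL⟩ := Track.tower_logs hM hbone hbL hLb
  -- budget
  have hg0 : 0 < bareBal β := Track.bareBal_pos hβpos
  have hx0eq : 1 / bareBal β ^ 2 = 2 * β := Track.one_div_bareBal_sq hβpos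
  have haK : a * (((k + 1 : ℕ)) : ℝ) = 8 * b0 * (((k : ℝ) + 1) * Real.log (M : ℝ)) := by rw [ha8]; push_cast; ring
  have hx0X : X ≤ 1 / bareBal β ^ 2 := by rw [hx0eq]; linarith
  have hbud : X ≤ 1 / bareBal β ^ 2 - a * (((k + 1 : ℕ)) : ℝ) -
      κ * (Real.log ((1 / bareBal β ^ 2) / X) + C₂ + a / m) - R := by
    rw [hx0eq, haK]
    have hbr := Track.log_bracket_budget hβpos hXpos
    have hbrκ : κ * Real.log (2 * b0 / β) + κ * Real.log (2 * β / X) = κ * Real.log (4 * b0) - κ * Real.log X := by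
      linear_combination (-κ) * hbr
    have hlog4 : Real.log (4 * b0) ≤ Real.log X := Real.log_le_log (by positivity) hX_4b0
    have hk1 : κ * Real.log (4 * b0) ≤ κ * Real.log X := mul_le_mul_of_nonneg_left hlog4 hκ0
    have hk2 : 8 * b0 * (((k : ℝ) + 1) * Real.log (M : ℝ)) ≤ 8 * b0 * Real.log (L : ℝ) :=
      mul_le_mul_of_nonneg_left hAL (by positivity)
    have hsplit : κ * (Real.log (2 * β / X) + C₂ + a / m) = κ * Real.log (2 * β / X) + (κ * (C₂ + a / m) + R) - R := by ring
    rw [hsplit, ← hC']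
    linarith
  obtain ⟨hfl, hid, _⟩ := TowerFlow.run_control S hγ ha hb1inf hC₁ hc₀ hθ₀ hθ₀1 hC₃ hc₁ hθ₁ hθ₁1 hAF0 hAF1 hTL
    hκ hG hgm hR hm hBc hC₂ hg0 hX_m hX_box hx0X hbud
  refine ⟨fun n hn => ?_, fun n hn => ?_⟩
  · obtain ⟨h1, h2⟩ := hfl n hn
    refine ⟨h1, ?_⟩
    rw [← hX]; exact h2
  · have h := hid n hn
    linarith

end Track

end Summit.QuantumFields.YangMills.Theorems.FemtoTransferGap.TwoLattice

end
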